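import Mathlib
import Summits.ValiantsHypothesis.ValiantsHypothesis.Theorems.BarrierLeverPartitionMinorsHitByVPHiddenStatesTwoUnfed

/-!
# Route BarrierLever — item `PartitionMinorsHitByVP` (stmt-ValiantsHypothesis-19717), line `hidden-states`:
# ★ ONE UNFED TOKEN AND A TRAP FOR THE OTHERS — the cross minor vanishes (criterion 1UZ)

Helper file (`--supports stmt-ValiantsHypothesis-19717`; cell valiant-natproofs, 𝒟-side door (c), registered line
`Cruxes/PartitionMinorsHitByVP/Lines/hidden_states.lean` v8; prover seat val-np-p6 gen 17).  Closes NO item; definition-free.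

THEOREM 1UZ (memo HOME/val-np-p6/g17/MEMO-valnp6-g17.md §4).  Table `w` (any), rows `(B_t ∖ {A}) ∪ {C'}`, `|A| = t`, `|C'| = t+1`, columns
the points of size `≤ t`.  Let `q ∈ C' ∖ A` be UNFED (`w q q = 1`, nobody's source) and `C'' = C' ∖ q`.  If a FORWARD-CLOSED set `F`
(`a ∈ F`, `w a d ≠ 0 ⇒ d ∈ F`) has `|A ∩ F| < |C'' ∩ F|`, the monomial matrix is singular (★ `det_eq_zero_of_one_unfed_fwd`).
Mechanism: the single peel `E = peelOp q` sends the coefficient vector of every row through `q` to `0` (rows of the ball) or to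
`s_q · coef C''` (the exceptional row), and fixes the `q`-free rows; injective source maps never decrease the number of `F`-tokens
(`card_inter_le_of_coef_ne_zero`), so the `q`-free `t`-rows with `≥ |C''∩F|` tokens in `F` together with `s_q · coef C''` are
`|𝓡| + 1` vectors supported on `|𝓡|` coordinates — the whole family of `E`-images fails to span, a nonzero `κ` kills it, and `κ ∘ E`
kills every row.  (The merge of the history is forced onto the unfed token; the rest is merge-free and trapped.)  Covers the t = 3 class
{012,013;0234,1234} (q = the common top 4, F = {1,3}).

WHAT THIS IS NOT: no cell is stated here; nothing on crux 14610 or VP ≠ VNP.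
-/

set_option linter.dupNamespace false

namespace Summit.ValiantsHypothesis.ValiantsHypothesis.Theorems.BarrierLever.HiddenStates

open Finset

noncomputable section

namespace SecondShell

open PathTable (mono_expand)

variable {ι : Type} [Fintype ι] [DecidableEq ι]

/-- injective source maps of nonzero weight do not decrease the number of tokens in a forward-closed set. -/
theorem card_inter_le_of_coef_ne_zero (w : ι → ι → ℂ) (F : Finset ι) (hF : ∀ a ∈ F, ∀ d, w a d ≠ 0 → d ∈ F)
    {S R : Finset ι} (h : coef w S R ≠ 0) (hcard : R.card = S.card) : (S ∩ F).card ≤ (R ∩ F).card := by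
  classical
  obtain ⟨φ, _, hφ⟩ := Finset.exists_ne_zero_of_sum_ne_zero h
  have himg : S.image φ = R := by
    by_contra hne; rw [if_neg hne, mul_zero] at hφ; exact hφ rfl
  have hwt : ∀ b ∈ S, w b (φ b) ≠ 0 := by
    intro b hb h0; apply hφ; rw [Finset.prod_eq_zero hb h0, zero_mul]
  have hinj : Set.InjOn φ ↑S := Finset.injOn_of_card_image_eq (by rw [himg, hcard])
  calc (S ∩ F).card = ((S ∩ F).image φ).card := by
        rw [Finset.card_image_of_injOn (hinj.mono (by intro x hx; exact (Finset.mem_inter.1 (Finset.mem_coe.1 hx)).1))]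
    _ ≤ (R ∩ F).card := by
        refine Finset.card_le_card fun x hx => ?_
        obtain ⟨b, hb, rfl⟩ := Finset.mem_image.1 hx
        rw [Finset.mem_inter] at hb
        exact Finset.mem_inter.2 ⟨himg ▸ Finset.mem_image_of_mem φ hb.1, hF b hb.2 (φ b) (hwt b hb.1)⟩

/-- the single peel on the rows: at a `q`-free `R` of size `t`, for `S` with `|S| ≤ t+1` and `|S| = t+1 ⇒ q ∈ S`,
`peelOp q (coef S) R = coef S R` if `q ∉ S`, `= (Σ_{d∈R} w q d)·coef (S∖q) R` if `q ∈ S`. -/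
theorem peel_coef_row (w : ι → ι → ℂ) {q : ι} (hcol : ∀ a, a ≠ q → w a q = 0) (hqq : w q q = 1)
    {S R : Finset ι} (hqR : q ∉ R) :
    peelOp w q (coef w S) R = if q ∈ S then (∑ d ∈ R, w q d) * coef w (S.erase q) R else coef w S R := by
  by_cases hq : q ∈ S
  · rw [if_pos hq]
    have hS : S = insert q (S.erase q) := (Finset.insert_erase hq).symm
    rw [hS, Finset.erase_insert (Finset.notMem_erase q S)]
    exact peelOp_coef_insert w hcol hqq (Finset.notMem_erase q S) hqR
  · rw [if_neg hq]; exact peelOp_coef_of_notMem w hcol hq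

/-- ★ **THEOREM 1UZ (forward form).** -/
theorem det_eq_zero_of_one_unfed_fwd (w : ι → ι → ℂ) {q : ι} (hcol : ∀ a, a ≠ q → w a q = 0) (hqq : w q q = 1)
    (F : Finset ι) (hF : ∀ a ∈ F, ∀ d, w a d ≠ 0 → d ∈ F)
    (t : ℕ) {r : ℕ} (u colJ : Fin r → Finset ι) (hcolJ : ∀ kk, (colJ kk).card ≤ t)
    (i₀ : Fin r) (hC : (u i₀).card = t + 1) (hqC : q ∈ u i₀)
    (A : Finset ι) (hAcard : A.card = t) (hqA : q ∉ A) (hA : ∀ i, u i ≠ A)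
    (hrows : ∀ i, i ≠ i₀ → (u i).card ≤ t)
    (hall : ∀ R : Finset ι, R.card ≤ t → R ≠ A → ∃ i, i ≠ i₀ ∧ u i = R)
    (hcount : (A ∩ F).card < ((u i₀).erase q ∩ F).card) :
    (Matrix.of fun i kk : Fin r => ∏ a ∈ u i, ∑ d ∈ colJ kk, w a d).det = 0 := by
  classical
  set Bt := {R : Finset ι // R.card ≤ t}
  set Tq := {R : Finset ι // R.card = t ∧ q ∉ R}
  set C'' := (u i₀).erase q with hC''
  have hC''card : C''.card = t := by rw [hC'', Finset.card_erase_of_mem hqC, hC]; rfl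
  set c := (C'' ∩ F).card with hc
  let v : Fin r → Bt → ℂ := fun i R => coef w (u i) R.1
  -- the target family of `E`-images: `vec S` for `q`-free `t`-rows `S ≠ A`, and the exceptional `xtra`
  let vec : Finset ι → Tq → ℂ := fun S R => coef w S R.1
  let xtra : Tq → ℂ := fun R => (∑ d ∈ R.1, w q d) * coef w C'' R.1
  -- index type of the family and the trapped sub-family
  set I := {S : Finset ι // S.card = t ∧ q ∉ S ∧ S ≠ A}
  let fam : Option I → Tq → ℂ := fun o => match o with | none => xtra | some S => vec S.1
  -- supports: injective images keep `≥ c` tokens in `F`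
  have hsupp_vec : ∀ (S : Finset ι) (R : Tq), S.card = t → c ≤ (S ∩ F).card → vec S R ≠ 0 → c ≤ (R.1 ∩ F).card := by
    intro S R hS hcS hne
    exact hcS.trans (card_inter_le_of_coef_ne_zero w F hF hne (by rw [R.2.1, hS]))
  have hsupp_xtra : ∀ R : Tq, xtra R ≠ 0 → c ≤ (R.1 ∩ F).card := by
    intro R hne
    have h' : coef w C'' R.1 ≠ 0 := fun h0 => hne (by simp only [xtra, h0, mul_zero])
    exact card_inter_le_of_coef_ne_zero w F hF h' (by rw [R.2.1, hC''card])
  -- the sub-family indexed by `J := {S ∈ I : c ≤ |S ∩ F|} ⊕ ⋆` is supported on `𝓡 := {R : c ≤ |R ∩ F|}` and has `|𝓡| + 1` members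
  set J := {S : I // c ≤ (S.1 ∩ F).card}
  let sub : Option J → Tq → ℂ := fun o => match o with | none => xtra | some S => vec S.1.1
  set Rc : Finset Tq := Finset.univ.filter fun R : Tq => c ≤ (R.1 ∩ F).card with hRc
  set W : Submodule ℂ (Tq → ℂ) := Submodule.span ℂ (↑(Rc.image fun R : Tq => (Pi.single R (1 : ℂ) : Tq → ℂ)) : Set (Tq → ℂ))
    with hW
  have hWdim : Module.finrank ℂ W ≤ Rc.card := (finrank_span_finset_le_card _).trans Finset.card_image_le
  have hmemW : ∀ g : Tq → ℂ, (∀ R, g R ≠ 0 → c ≤ (R.1 ∩ F).card) → g ∈ W := by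
    intro g hg
    have hg' : g = ∑ R ∈ Rc, g R • (Pi.single R (1 : ℂ) : Tq → ℂ) := by
      funext R'
      simp only [Finset.sum_apply, Pi.smul_apply, Pi.single_apply, smul_eq_mul, mul_ite, mul_one, mul_zero]
      rw [Finset.sum_ite_eq]
      by_cases hR' : R' ∈ Rc
      · rw [if_pos hR']
      · rw [if_neg hR']
        by_contra hne
        exact hR' (Finset.mem_filter.2 ⟨Finset.mem_univ _, hg R' hne⟩)
    rw [hg']
    refine Submodule.sum_mem _ fun R hR => Submodule.smul_mem _ _ (Submodule.subset_span ?_)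
    rw [Finset.coe_image]; exact ⟨R, hR, rfl⟩
  have hsub_mem : ∀ o, sub o ∈ W := by
    intro o
    rcases o with _ | S
    · exact hmemW xtra hsupp_xtra
    · exact hmemW (vec S.1.1) (fun R hR => hsupp_vec S.1.1 R S.1.2.1 S.2 hR)
  -- `|J| = |Rc|`: the `q`-free `t`-sets with `≥ c` tokens in `F` are never `A`
  have hJcard : Fintype.card J = Rc.card := by
    have eJ : J ≃ {R : Tq // c ≤ (R.1 ∩ F).card} :=
      { toFun := fun R => ⟨⟨R.1.1, R.1.2.1, R.1.2.2.1⟩, R.2⟩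
        invFun := fun S => ⟨⟨S.1.1, S.1.2.1, S.1.2.2, fun h => by
            have h2 := S.2
            have : (S.1.1 ∩ F).card = (A ∩ F).card := by rw [h]
            rw [this] at h2
            exact absurd hcount (not_lt.2 h2)⟩, S.2⟩
        left_inv := fun R => rfl
        right_inv := fun S => rfl }
    rw [Fintype.card_congr eJ, Fintype.card_subtype]
  have hsub_dep : ¬ LinearIndependent ℂ sub := by
    intro hli
    rw [linearIndependent_iff_card_le_finrank_span, Fintype.card_option] at hli
    have hle : Set.finrank ℂ (Set.range sub) ≤ Module.finrank ℂ W := by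
      apply Submodule.finrank_mono
      rw [Submodule.span_le]
      rintro _ ⟨o, rfl⟩
      exact hsub_mem o
    rw [hJcard] at hli
    omega
  -- hence the full family is dependent and does not span
  have hfam_dep : ¬ LinearIndependent ℂ fam := by
    intro hli
    apply hsub_dep
    have : sub = fam ∘ (fun o : Option J => (o.map fun S => S.1 : Option I)) := by
      funext o; rcases o with _ | S <;> rfl
    rw [this]
    exact hli.comp _ (Option.map_injective Subtype.val_injective)
  have hIcard : Fintype.card (Option I) = Fintype.card Tq := by
    rw [Fintype.card_option]
    have h1 : Fintype.card I = (Finset.univ.filter fun S : Finset ι => S.card = t ∧ q ∉ S ∧ S ≠ A).card := by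
      simp only [I]; rw [Fintype.card_subtype]
    have h2 : Fintype.card Tq = (Finset.univ.filter fun S : Finset ι => S.card = t ∧ q ∉ S).card := by
      simp only [Tq]; rw [Fintype.card_subtype]
    have h3 : (Finset.univ.filter fun S : Finset ι => S.card = t ∧ q ∉ S ∧ S ≠ A) =
        (Finset.univ.filter fun S : Finset ι => S.card = t ∧ q ∉ S).erase A := by
      ext S; simp only [Finset.mem_filter, Finset.mem_univ, true_and, Finset.mem_erase]; tauto
    have hAmem : A ∈ Finset.univ.filter (fun S : Finset ι => S.card = t ∧ q ∉ S) :=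
      Finset.mem_filter.2 ⟨Finset.mem_univ _, hAcard, hqA⟩
    rw [h1, h2, h3, Finset.card_erase_add_one hAmem]
  have hspan_lt : Submodule.span ℂ (Set.range fam) < ⊤ := by
    apply lt_of_le_of_ne le_top
    intro htop
    have h1 : Set.finrank ℂ (Set.range fam) ≤ Fintype.card (Option I) := finrank_range_le_card fam
    have h2 : Fintype.card (Option I) ≠ Set.finrank ℂ (Set.range fam) := fun h =>
      hfam_dep (linearIndependent_iff_card_eq_finrank_span.2 h)
    have h3 : Set.finrank ℂ (Set.range fam) = Module.finrank ℂ (Tq → ℂ) := by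
      show Module.finrank ℂ (Submodule.span ℂ (Set.range fam)) = _
      rw [htop, finrank_top]
    rw [Module.finrank_fintype_fun_eq_card, ← hIcard] at h3
    omega
  obtain ⟨κ, hκne, hκ⟩ := Submodule.exists_le_ker_of_lt_top _ hspan_lt
  have hκfam : ∀ o, κ (fam o) = 0 := fun o =>
    LinearMap.mem_ker.1 (hκ (Submodule.subset_span ⟨o, rfl⟩))
  -- the functional `θ = κ ∘ E`, `E` = single peel at `q`-free `t`-sets
  let Eop : (Bt → ℂ) → (Tq → ℂ) := fun g R => peelOp w q (extBall t g) R.1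
  have hEadd : ∀ g g', Eop (g + g') = Eop g + Eop g' := by
    intro g g'; funext R
    simp only [Eop, Pi.add_apply]
    have hext : extBall t (g + g') = extBall t g + extBall t g' := by
      funext X; simp only [extBall, Pi.add_apply]; split_ifs <;> simp
    rw [hext, peelOp_add]
  have hEsmul : ∀ (a : ℂ) g, Eop (a • g) = a • Eop g := by
    intro a g; funext R
    simp only [Eop, Pi.smul_apply, smul_eq_mul]
    have hext : extBall t (a • g) = a • extBall t g := by
      funext X; simp only [extBall, Pi.smul_apply, smul_eq_mul]; split_ifs <;> simp
    rw [hext, peelOp_smul]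
  let θ : (Bt → ℂ) →ₗ[ℂ] ℂ :=
    { toFun := fun g => κ (Eop g)
      map_add' := fun g g' => by simp only [hEadd, map_add]
      map_smul' := fun a g => by simp only [hEsmul, map_smul, RingHom.id_apply] }
  have hEv : ∀ i (R : Tq), Eop (v i) R =
      if q ∈ u i then (∑ d ∈ R.1, w q d) * coef w ((u i).erase q) R.1 else coef w (u i) R.1 := by
    intro i R
    have hagree : ∀ X : Finset ι, X.card = R.1.card → extBall t (v i) X = coef w (u i) X := by
      intro X hX
      simp only [extBall, v]
      rw [dif_pos (by rw [hX, R.2.1])]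
    simp only [Eop]
    rw [peelOp_congr_card w R.2.2 hagree]
    exact peel_coef_row w hcol hqq R.2.2
  have hθv : ∀ i, θ (v i) = 0 := by
    intro i
    change κ (Eop (v i)) = 0
    by_cases hqi : q ∈ u i
    · by_cases hi : i = i₀
      · subst hi
        have : Eop (v i) = fam none := by
          funext R; rw [hEv, if_pos hqi]
        rw [this]; exact hκfam none
      · have hlt : ((u i).erase q).card < t := by
          rw [Finset.card_erase_of_mem hqi]; have := hrows i hi; have := Finset.card_pos.2 ⟨q, hqi⟩; omega
        have : Eop (v i) = 0 := by
          funext R; rw [hEv, if_pos hqi, Pi.zero_apply, coef_eq_zero_of_card_lt w (by rw [R.2.1]; exact hlt), mul_zero]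
        rw [this, map_zero]
    · have hi : i ≠ i₀ := fun h => hqi (h ▸ hqC)
      by_cases hcard : (u i).card = t
      · have : Eop (v i) = fam (some ⟨u i, hcard, hqi, hA i⟩) := by
          funext R; rw [hEv, if_neg hqi]
        rw [this]; exact hκfam (some ⟨u i, hcard, hqi, hA i⟩)
      · have hlt : (u i).card < t := lt_of_le_of_ne (hrows i hi) hcard
        have : Eop (v i) = 0 := by
          funext R; rw [hEv, if_neg hqi, Pi.zero_apply]
          exact coef_eq_zero_of_card_lt w (by rw [R.2.1]; exact hlt)
        rw [this, map_zero]
  have hθne : θ ≠ 0 := by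
    obtain ⟨hfun, hh⟩ : ∃ hfun : Tq → ℂ, κ hfun ≠ 0 := by
      by_contra hno; push Not at hno
      exact hκne (LinearMap.ext hno)
    let g₀ : Bt → ℂ := fun R => if hR : R.1.card = t ∧ q ∉ R.1 then hfun ⟨R.1, hR⟩ else 0
    have hzero : ∀ X : Finset ι, q ∈ X → extBall t g₀ X = 0 := by
      intro X hX
      simp only [extBall, g₀]
      split_ifs with h1 h2
      · exact absurd hX h2.2
      · rfl
      · rfl
    have hE : Eop g₀ = hfun := by
      funext R
      simp only [Eop, peelOp]
      rw [Finset.sum_eq_zero (fun d _ => by rw [hzero _ (Finset.mem_insert_self _ _), mul_zero]), sub_zero]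
      simp only [extBall, g₀]
      rw [dif_pos (by rw [R.2.1]), dif_pos ⟨R.2.1, R.2.2⟩]
    intro hθ
    apply hh
    have : θ g₀ = 0 := by rw [hθ]; rfl
    change κ (Eop g₀) = 0 at this
    rwa [hE] at this
  -- dimension count: the `r` vectors `v i` lie in `ker θ`, of dimension `< |Bt| ≤ r`
  have hBt_le : Fintype.card Bt ≤ r := by
    classical
    let f : Bt → Fin r := fun R => if hRA : R.1 = A then i₀ else Classical.choose (hall R.1 R.2 hRA)
    refine (Fintype.card_le_of_injective f fun R R' hRR' => ?_).trans (by rw [Fintype.card_fin])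
    by_cases hRA : R.1 = A <;> by_cases hR'A : R'.1 = A
    · exact Subtype.ext (hRA.trans hR'A.symm)
    · exfalso
      have h1 : f R = i₀ := by simp only [f, dif_pos hRA]
      have hs := Classical.choose_spec (hall R'.1 R'.2 hR'A)
      have h2 : f R' = Classical.choose (hall R'.1 R'.2 hR'A) := by simp only [f, dif_neg hR'A]
      exact hs.1 (by rw [← h2, ← hRR', h1])
    · exfalso
      have h1 : f R' = i₀ := by simp only [f, dif_pos hR'A]
      have hs := Classical.choose_spec (hall R.1 R.2 hRA)
      have h2 : f R = Classical.choose (hall R.1 R.2 hRA) := by simp only [f, dif_neg hRA]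
      exact hs.1 (by rw [← h2, hRR', h1])
    · have hs := Classical.choose_spec (hall R.1 R.2 hRA)
      have hs' := Classical.choose_spec (hall R'.1 R'.2 hR'A)
      have h2 : f R = Classical.choose (hall R.1 R.2 hRA) := by simp only [f, dif_neg hRA]
      have h2' : f R' = Classical.choose (hall R'.1 R'.2 hR'A) := by simp only [f, dif_neg hR'A]
      apply Subtype.ext
      rw [← hs.2, ← hs'.2, ← h2, ← h2', hRR']
  have hdep : ¬ LinearIndependent ℂ v := by
    intro hli
    rw [linearIndependent_iff_card_le_finrank_span, Fintype.card_fin] at hli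
    have hle : Set.finrank ℂ (Set.range v) ≤ Module.finrank ℂ (LinearMap.ker θ) := by
      apply Submodule.finrank_mono
      rw [Submodule.span_le]
      rintro _ ⟨i, rfl⟩
      exact LinearMap.mem_ker.2 (hθv i)
    have hker : LinearMap.ker θ < ⊤ := lt_top_iff_ne_top.2 (fun h => hθne (LinearMap.ker_eq_top.1 h))
    have hlt := Submodule.finrank_lt_finrank_of_lt hker
    rw [finrank_top, Module.finrank_fintype_fun_eq_card] at hlt
    omega
  obtain ⟨g, hg, i₁, hi₁⟩ := Fintype.not_linearIndependent_iff.1 hdep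
  set M : Matrix (Fin r) (Fin r) ℂ := Matrix.of fun i kk : Fin r => ∏ a ∈ u i, ∑ d ∈ colJ kk, w a d with hM
  have hrow : ∀ i kk, M i kk = ∑ X ∈ (colJ kk).powerset, coef w (u i) X := by
    intro i kk
    rw [hM, Matrix.of_apply, mono_expand]
    have h1 : ∀ φ ∈ Fintype.piFinset (fun a => if a ∈ u i then (Finset.univ : Finset ι) else {a}),
        (∏ a ∈ u i, w a (φ a)) * (if ∀ a ∈ u i, φ a ∈ colJ kk then (1 : ℂ) else 0) =
        (∏ a ∈ u i, w a (φ a)) * (if (u i).image φ ⊆ colJ kk then (1 : ℂ) else 0) := by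
      intro φ _; congr 1; simp only [Finset.image_subset_iff]
    rw [Finset.sum_congr rfl h1, sum_maps_eq_sum_coef w (fun X => if X ⊆ colJ kk then (1 : ℂ) else 0) (u i)]
    rw [← Finset.sum_subset (Finset.subset_univ (colJ kk).powerset)]
    · exact Finset.sum_congr rfl fun X hX => by rw [if_pos (Finset.mem_powerset.1 hX), mul_one]
    · intro X _ hX; rw [if_neg (fun h => hX (Finset.mem_powerset.2 h)), mul_zero]
  have hrel : Matrix.vecMul g M = 0 := by
    funext kk
    rw [Matrix.vecMul, dotProduct, Pi.zero_apply]
    calc ∑ i, g i * M i kk = ∑ i, ∑ X ∈ (colJ kk).powerset, g i * coef w (u i) X :=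
          Finset.sum_congr rfl fun i _ => by rw [hrow, Finset.mul_sum]
      _ = ∑ X ∈ (colJ kk).powerset, ∑ i, g i * coef w (u i) X := Finset.sum_comm
      _ = 0 := by
          refine Finset.sum_eq_zero fun X hX => ?_
          have hXt : X.card ≤ t := (Finset.card_le_card (Finset.mem_powerset.1 hX)).trans (hcolJ kk)
          have := congrFun hg ⟨X, hXt⟩
          simpa [v, Finset.sum_apply, Pi.smul_apply, smul_eq_mul] using this
  by_contra hdet
  have hU : IsUnit M := (Matrix.isUnit_iff_isUnit_det M).2 (isUnit_iff_ne_zero.2 hdet)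
  have hinj := Matrix.vecMul_injective_iff_isUnit.2 hU
  have hg0 : g = 0 := hinj (hrel.trans (Matrix.zero_vecMul M).symm)
  exact hi₁ (by rw [hg0]; rfl)

end SecondShell

end

end Summit.ValiantsHypothesis.ValiantsHypothesis.Theorems.BarrierLever.HiddenStates
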